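/-
Copyright: derived here (Resolution Observatory cell `pub-rosobs`, carver gen 60). AI-written Lean; AI review is
weaker than expert review.  Companion file of the cell's POLYNOMIAL weighted-centre model `W(f)`: "a graded endomorphism
that fixes `g` fixes every homogeneous component of `g`" — the decomposition step of engine 1's LEMMA XL
(THEOREM-F-eng1-g40 §4b: "write `g = Σ_h h·G_h` over the monomials `h` in the heavy slots … uniqueness of this decomposition
(coefficientwise in `σ`) turns `X(g) = g` into `X(G_h) = G_h` for every `h`").
Instrument — NOT a resolution theorem and NOT a statement about the invariant of [AbramovichTemkinWlodarczyk2024].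
-/
import Literature.AlgebraicGeometry.Resolution.WeightedCentreGradedIsotropy
import Mathlib.Algebra.MvPolynomial.Division
import HarnessLib

/-!
# Graded endomorphisms fix the homogeneous components of what they fix

Setting of `WeightedCentreGradedIsotropy`: `A₀ = k[ε_ι] = MvPolynomial ι k` with weights `w : ι → M` in an additive group,
`A₀[σ] = A₀[X]` with `deg σ = ρ`, and a ring endomorphism `Φ` of `A₀[σ]` that is GRADED (`IsGradedHom w ρ Φ`: scalars fixed,
`Φ σ` of total weight `ρ`, `Φ ε_i` of total weight `w i`).  `IsIsotropyOf g Φ` means `Φ g = g` for a constant `g ∈ k[ε]`.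

Results (all elementary bookkeeping, ours):

* `weightedHomogeneousComponent_map_of_gradedShift` — an ADDITIVE map `ψ : k[ε] → k[ε]` sending weight-`n` homogeneous
  polynomials to weight-`τ n` homogeneous ones, `τ` injective, satisfies `comp_{τ n} ∘ ψ = ψ ∘ comp_n` (the algebra-map,
  `τ = id` case is `WeightedCentrePinCriterion.weightedHomogeneousComponent_map_of_graded`);
* `IsGradedHom.weightedHomogeneousComponent_coeff_map_C` — for a graded `Φ`: `comp_{m − s•ρ} ([σ^s] Φ(g)) = [σ^s] Φ(comp_m g)`;
* **`IsGradedHom.isIsotropyOf_weightedHomogeneousComponent`** — `Φ g = g ⇒ Φ (comp_m g) = comp_m g` for every weight `m`,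
  and the equivalence `IsGradedHom.isIsotropyOf_iff_forall_weightedHomogeneousComponent`; `IsGradedIso.weightedHomogeneousComponent`;
* the DIVISION step: `isIsotropyOf_of_isIsotropyOf_mul` (`Φ h = h`, `h` a non-zero-divisor, `Φ (h·G) = h·G ⇒ Φ G = G`) and its
  monomial case `isIsotropyOf_of_isIsotropyOf_monomial_mul` (`h = ε^d` a monomial in slots FIXED by `Φ`);
* the HEAVY MULTIGRADING `heavyMultiweight H : ι → (ι →₀ ℤ)` (`ε_i ↦ e_i` for `i ∈ H`, `0` otherwise, `deg σ = 0`): weight-`0` means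
  "free of the slots in `H`" (`isWeightedHomogeneous_heavyMultiweight_zero_iff`), and an endomorphism fixing the scalars, `σ` and the
  slots of `H` and mapping the other slots to `H`-free elements is graded for it (`isGradedHom_heavyMultiweight`) — so LEMMA XL's
  `X(g) = g ⇒ X(g_e) = g_e` for every heavy exponent `e` is `IsGradedHom.isIsotropyOf_weightedHomogeneousComponent`, and
  `X(G_e) = G_e` after factoring `g_e = ε^e·G_e` is `isIsotropyOf_of_isIsotropyOf_monomial_mul`;
* the FACTORISATION itself (`section Factor`): `heavyComponent H e g = g_e`, `heavyQuotient H e g = G_e := g_e / ε^e` (Mathlib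
  `divMonomial`), `heavyComponent_eq_monomial_mul_heavyQuotient` (`g_e = ε^e·G_e` for `e` supported in `H`), `isWeightedHomogeneous_heavyQuotient`
  (`G_e` is `H`-free) and the conclusion **`isIsotropyOf_heavyQuotient`** (`X(g) = g ⇒ X(G_e) = G_e`).

[ATW24] Abramovich–Temkin–Włodarczyk, Algebra & Number Theory 18 (2024), §3.4 (p. 1570), Thm. 5.3.1 (p. 1578).  CONTEXT ONLY.
-/

namespace Literature.AlgebraicGeometry.Resolution.WeightedBlowup

open Polynomial

section Shift

variable {R : Type*} [CommSemiring R] {σ : Type*} {M : Type*} [AddCommMonoid M]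

/-- An additive map that sends weight-`n` homogeneous polynomials to weight-`τ n` homogeneous polynomials, for an
INJECTIVE shift `τ`, commutes with taking homogeneous components: `comp_{τ n} (ψ P) = ψ (comp_n P)` (ours).
[cite: AbramovichTemkinWlodarczyk2024, §3.4 (p. 1570)] -/
theorem weightedHomogeneousComponent_map_of_gradedShift (w : σ → M) {τ : M → M} (hτ : Function.Injective τ)
    (ψ : MvPolynomial σ R →+ MvPolynomial σ R)
    (hψ : ∀ (n : M) (P : MvPolynomial σ R),
      MvPolynomial.IsWeightedHomogeneous w P n → MvPolynomial.IsWeightedHomogeneous w (ψ P) (τ n))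
    (P : MvPolynomial σ R) (n : M) :
    MvPolynomial.weightedHomogeneousComponent w (τ n) (ψ P) =
      ψ (MvPolynomial.weightedHomogeneousComponent w n P) := by
  classical
  conv_lhs => rw [P.as_sum, map_sum, map_sum]
  rw [MvPolynomial.weightedHomogeneousComponent_apply, map_sum, Finset.sum_filter]
  refine Finset.sum_congr rfl fun d _ => ?_
  rw [MvPolynomial.weightedHomogeneousComponent_of_mem
    (hψ _ _ (MvPolynomial.isWeightedHomogeneous_monomial w d (MvPolynomial.coeff d P) rfl))]
  by_cases h : Finsupp.weight w d = n
  · rw [if_pos (congrArg τ h).symm, if_pos h]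
  · rw [if_neg (fun h' => h (hτ h').symm), if_neg h]

/-- Off the image of the shift the components of `ψ P` vanish: `comp_m (ψ P) = 0` if `m ∉ range τ` (ours).
[cite: AbramovichTemkinWlodarczyk2024, §3.4 (p. 1570)] -/
theorem weightedHomogeneousComponent_map_eq_zero_of_notMem_range (w : σ → M) {τ : M → M}
    (ψ : MvPolynomial σ R →+ MvPolynomial σ R)
    (hψ : ∀ (n : M) (P : MvPolynomial σ R),
      MvPolynomial.IsWeightedHomogeneous w P n → MvPolynomial.IsWeightedHomogeneous w (ψ P) (τ n))
    (P : MvPolynomial σ R) {m : M} (hm : m ∉ Set.range τ) :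
    MvPolynomial.weightedHomogeneousComponent w m (ψ P) = 0 := by
  classical
  rw [P.as_sum, map_sum, map_sum]
  refine Finset.sum_eq_zero fun d _ => ?_
  rw [MvPolynomial.weightedHomogeneousComponent_of_mem
    (hψ _ _ (MvPolynomial.isWeightedHomogeneous_monomial w d (MvPolynomial.coeff d P) rfl)), if_neg]
  exact fun h => hm ⟨_, h.symm⟩

end Shift

section Graded

variable {k : Type*} [CommRing k] {ι : Type*} {M : Type*} [AddCommGroup M] {w : ι → M} {ρ : M}

/-- The additive map `g ↦ [σ^s] Φ(g)` on constants (ours). [cite: AbramovichTemkinWlodarczyk2024, Thm. 5.3.1 (2)–(3) (p. 1578)] -/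
noncomputable def coeffMapC (Φ : (MvPolynomial ι k)[X] →+* (MvPolynomial ι k)[X]) (s : ℕ) :
    MvPolynomial ι k →+ MvPolynomial ι k where
  toFun g := (Φ (C g)).coeff s
  map_zero' := by simp
  map_add' a b := by simp [map_add]

/-- Unfolding lemma (ours). [cite: AbramovichTemkinWlodarczyk2024, Thm. 5.3.1 (2)–(3) (p. 1578)] -/
@[simp] theorem coeffMapC_apply (Φ : (MvPolynomial ι k)[X] →+* (MvPolynomial ι k)[X]) (s : ℕ) (g : MvPolynomial ι k) :
    coeffMapC Φ s g = (Φ (C g)).coeff s := rfl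

/-- For a GRADED endomorphism, taking the `σ^s`-coefficient of `Φ(g)` shifts homogeneous components by `−s•ρ`:
`comp_{m − s•ρ} ([σ^s] Φ g) = [σ^s] Φ (comp_m g)` (ours). [cite: AbramovichTemkinWlodarczyk2024, Thm. 5.3.1 (2)–(3) (p. 1578)] -/
theorem IsGradedHom.weightedHomogeneousComponent_coeff_map_C {Φ : (MvPolynomial ι k)[X] →+* (MvPolynomial ι k)[X]}
    (hΦ : IsGradedHom w ρ Φ) (g : MvPolynomial ι k) (m : M) (s : ℕ) :
    MvPolynomial.weightedHomogeneousComponent w (m - s • ρ) ((Φ (C g)).coeff s) =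
      (Φ (C (MvPolynomial.weightedHomogeneousComponent w m g))).coeff s := by
  have h := weightedHomogeneousComponent_map_of_gradedShift w (τ := fun n : M => n - s • ρ) sub_left_injective
    (coeffMapC Φ s) (fun n P hP => hΦ.isTW_map_C hP s) g m
  simpa only [coeffMapC_apply] using h

/-- **A graded endomorphism that fixes `g` fixes every homogeneous component of `g`**: `Φ g = g ⇒ Φ (comp_m g) = comp_m g`
(ours; LEMMA XL's "uniqueness of the decomposition, coefficientwise in `σ`").
[cite: AbramovichTemkinWlodarczyk2024, Thm. 5.3.1 (2)–(3) (p. 1578)] -/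
theorem IsGradedHom.isIsotropyOf_weightedHomogeneousComponent {Φ : (MvPolynomial ι k)[X] →+* (MvPolynomial ι k)[X]}
    (hΦ : IsGradedHom w ρ Φ) {g : MvPolynomial ι k} (hg : IsIsotropyOf g Φ) (m : M) :
    IsIsotropyOf (MvPolynomial.weightedHomogeneousComponent w m g) Φ := by
  classical
  unfold IsIsotropyOf at hg ⊢
  refine Polynomial.ext fun s => ?_
  rw [← hΦ.weightedHomogeneousComponent_coeff_map_C g m s, hg, coeff_C, coeff_C]
  split_ifs with hs
  · subst hs
    rw [zero_smul, sub_zero]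
  · exact map_zero _

/-- Conversely (and hence iff): `Φ` fixes `g` iff it fixes every homogeneous component of `g` (ours).
[cite: AbramovichTemkinWlodarczyk2024, Thm. 5.3.1 (2)–(3) (p. 1578)] -/
theorem IsGradedHom.isIsotropyOf_iff_forall_weightedHomogeneousComponent
    {Φ : (MvPolynomial ι k)[X] →+* (MvPolynomial ι k)[X]} (hΦ : IsGradedHom w ρ Φ) (g : MvPolynomial ι k) :
    IsIsotropyOf g Φ ↔ ∀ m : M, IsIsotropyOf (MvPolynomial.weightedHomogeneousComponent w m g) Φ := by
  classical
  refine ⟨fun hg m => hΦ.isIsotropyOf_weightedHomogeneousComponent hg m, fun h => ?_⟩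
  unfold IsIsotropyOf at h ⊢
  have hfin := MvPolynomial.weightedHomogeneousComponent_finsupp (w := w) g
  conv_lhs => rw [← MvPolynomial.sum_weightedHomogeneousComponent w g, finsum_eq_sum _ hfin]
  conv_rhs => rw [← MvPolynomial.sum_weightedHomogeneousComponent w g, finsum_eq_sum _ hfin]
  simp only [map_sum]
  exact Finset.sum_congr rfl fun m _ => h m

/-- A graded isotropy of `G` is a graded isotropy of every homogeneous component of `G` (ours).
[cite: AbramovichTemkinWlodarczyk2024, Thm. 5.3.1 (2)–(3) (p. 1578)] -/
theorem IsGradedIso.weightedHomogeneousComponent {G : MvPolynomial ι k} {Φ : (MvPolynomial ι k)[X] →+* (MvPolynomial ι k)[X]}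
    (hΦ : IsGradedIso w ρ G Φ) (m : M) : IsGradedIso w ρ (MvPolynomial.weightedHomogeneousComponent w m G) Φ where
  graded := hΦ.graded
  map_X := hΦ.map_X
  iso := hΦ.graded.isIsotropyOf_weightedHomogeneousComponent hΦ.iso m

/-- Off-weight vanishing for a graded `Φ`: if `g` is homogeneous of weight `m`, then `comp_n ([σ^s] Φ g) = 0` unless
`n = m − s•ρ` (ours). [cite: AbramovichTemkinWlodarczyk2024, Thm. 5.3.1 (2)–(3) (p. 1578)] -/
theorem IsGradedHom.weightedHomogeneousComponent_coeff_map_C_eq_zero {Φ : (MvPolynomial ι k)[X] →+* (MvPolynomial ι k)[X]}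
    (hΦ : IsGradedHom w ρ Φ) {g : MvPolynomial ι k} {m : M} (hg : MvPolynomial.IsWeightedHomogeneous w g m)
    (s : ℕ) {n : M} (hn : n ≠ m - s • ρ) :
    MvPolynomial.weightedHomogeneousComponent w n ((Φ (C g)).coeff s) = 0 :=
  (hΦ.isTW_map_C hg s).weightedHomogeneousComponent_ne n hn

end Graded

section Division

variable {A₀ : Type*} [CommRing A₀]

/-- DIVISION STEP: if `Φ` fixes a non-zero-divisor `h` and fixes `h·G`, then it fixes `G` (ours; LEMMA XL: "`X(h·G_h) = h·X(G_h)`,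
so `X(g) = g` gives `X(G_h) = G_h`"). [cite: AbramovichTemkinWlodarczyk2024, Thm. 5.3.1 (2)–(3) (p. 1578)] -/
theorem isIsotropyOf_of_isIsotropyOf_mul {Φ : A₀[X] →+* A₀[X]} {h G : A₀} (hh : IsIsotropyOf h Φ)
    (hreg : IsLeftRegular h) (hfix : IsIsotropyOf (h * G) Φ) : IsIsotropyOf G Φ := by
  unfold IsIsotropyOf at hh hfix ⊢
  rw [map_mul C, map_mul Φ, hh, ← map_mul C] at hfix
  -- `C h * Φ (C G) = C (h * G)`; compare `σ^s`-coefficients and cancel `h`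
  refine Polynomial.ext fun s => hreg ?_
  have := congrArg (fun q : A₀[X] => q.coeff s) hfix
  simpa only [coeff_C_mul, coeff_C, mul_ite, mul_zero] using this

/-- Conversely `Φ G = G ⇒ Φ (h·G) = h·G` whenever `Φ h = h` (ours). [cite: AbramovichTemkinWlodarczyk2024, Thm. 5.3.1 (2)–(3) (p. 1578)] -/
theorem IsIsotropyOf.mul {Φ : A₀[X] →+* A₀[X]} {h G : A₀} (hh : IsIsotropyOf h Φ) (hG : IsIsotropyOf G Φ) :
    IsIsotropyOf (h * G) Φ := by
  unfold IsIsotropyOf at hh hG ⊢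
  rw [map_mul, map_mul, hh, hG]

variable {k : Type*} [CommRing k] {ι : Type*}

/-- A monomial `ε^d` in slots fixed by `Φ` is fixed by `Φ` (ours). [cite: AbramovichTemkinWlodarczyk2024, Thm. 5.3.1 (2)–(3) (p. 1578)] -/
theorem isIsotropyOf_monomial_one {Φ : (MvPolynomial ι k)[X] →+* (MvPolynomial ι k)[X]} (d : ι →₀ ℕ)
    (hfix : ∀ i ∈ d.support, Φ (C (MvPolynomial.X i)) = C (MvPolynomial.X i)) :
    IsIsotropyOf (MvPolynomial.monomial d (1 : k)) Φ := by
  unfold IsIsotropyOf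
  rw [MvPolynomial.monomial_eq, MvPolynomial.C_1, one_mul, Finsupp.prod]
  simp only [map_prod, map_pow]
  exact Finset.prod_congr rfl fun i hi => by rw [hfix i hi]

/-- Monomials are non-zero-divisors in `k[ε]` (Mathlib's `isRegular_X_pow`, assembled; ours).
[cite: AbramovichTemkinWlodarczyk2024, Thm. 5.3.1 (2)–(3) (p. 1578)] -/
theorem isRegular_monomial_one (d : ι →₀ ℕ) : IsRegular (MvPolynomial.monomial d (1 : k)) := by
  rw [MvPolynomial.monomial_eq, MvPolynomial.C_1, one_mul, Finsupp.prod]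
  exact IsRegular.prod fun i _ => MvPolynomial.isRegular_X_pow (d i)

/-- **LEMMA XL's decomposition step, divided form**: if `Φ` fixes the slots occurring in the monomial `ε^d` and fixes `ε^d·G`,
then `Φ G = G` (ours). [cite: AbramovichTemkinWlodarczyk2024, Thm. 5.3.1 (2)–(3) (p. 1578)] -/
theorem isIsotropyOf_of_isIsotropyOf_monomial_mul {Φ : (MvPolynomial ι k)[X] →+* (MvPolynomial ι k)[X]} {d : ι →₀ ℕ}
    (hfix : ∀ i ∈ d.support, Φ (C (MvPolynomial.X i)) = C (MvPolynomial.X i)) {G : MvPolynomial ι k}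
    (h : IsIsotropyOf (MvPolynomial.monomial d 1 * G) Φ) : IsIsotropyOf G Φ :=
  isIsotropyOf_of_isIsotropyOf_mul (isIsotropyOf_monomial_one d hfix) (isRegular_monomial_one d).left h

end Division

section Heavy

variable {k : Type*} [CommRing k] {ι : Type*}

/-- The HEAVY MULTIGRADING attached to a set `H` of slots: `ε_i` has weight `e_i ∈ ι →₀ ℤ` for `i ∈ H` and weight `0` otherwise
(and `deg σ = 0`) — the grading whose homogeneous components are LEMMA XL's `h·G_h`, `h` a monomial in the slots of `H` (ours).
[cite: AbramovichTemkinWlodarczyk2024, Thm. 5.3.1 (2)–(3) (p. 1578)] -/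
noncomputable def heavyMultiweight (H : Set ι) [DecidablePred (· ∈ H)] : ι → (ι →₀ ℤ) :=
  fun i => if i ∈ H then Finsupp.single i 1 else 0

/-- The heavy multiweight of an exponent vector `d` is `d` restricted to `H` (coordinatewise; ours).
[cite: AbramovichTemkinWlodarczyk2024, Thm. 5.3.1 (2)–(3) (p. 1578)] -/
theorem weight_heavyMultiweight_apply (H : Set ι) [DecidablePred (· ∈ H)] (d : ι →₀ ℕ) (j : ι) :
    Finsupp.weight (heavyMultiweight H) d j = if j ∈ H then (d j : ℤ) else 0 := by
  classical
  rw [Finsupp.weight_apply, Finsupp.sum, Finsupp.finsetSum_apply]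
  have hterm : ∀ i ∈ d.support,
      (d i • heavyMultiweight H i) j = if i = j then (if j ∈ H then (d j : ℤ) else 0) else 0 := by
    intro i _
    rw [Finsupp.smul_apply]
    unfold heavyMultiweight
    by_cases hij : i = j
    · subst hij
      by_cases hi : i ∈ H
      · simp [hi]
      · simp [hi]
    · by_cases hi : i ∈ H
      · simp [hi, hij]
      · simp [hi, hij]
  rw [Finset.sum_congr rfl hterm, Finset.sum_ite_eq']
  by_cases hdj : j ∈ d.support
  · rw [if_pos hdj]
  · rw [if_neg hdj, Finsupp.notMem_support_iff.mp hdj, Nat.cast_zero, ite_self]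

/-- `heavyMultiweight`-weight `0` means: every exponent in a slot of `H` vanishes (ours). [cite: AbramovichTemkinWlodarczyk2024, Thm. 5.3.1 (2)–(3) (p. 1578)] -/
theorem weight_heavyMultiweight_eq_zero_iff (H : Set ι) [DecidablePred (· ∈ H)] (d : ι →₀ ℕ) :
    Finsupp.weight (heavyMultiweight H) d = 0 ↔ ∀ j ∈ H, d j = 0 := by
  rw [Finsupp.ext_iff]
  refine ⟨fun h j hj => ?_, fun h j => ?_⟩
  · have := h j
    rw [weight_heavyMultiweight_apply, if_pos hj, Finsupp.coe_zero, Pi.zero_apply] at this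
    exact_mod_cast this
  · rw [weight_heavyMultiweight_apply, Finsupp.coe_zero, Pi.zero_apply]
    split_ifs with hj
    · rw [h j hj, Nat.cast_zero]
    · rfl

/-- A polynomial is `heavyMultiweight H`-homogeneous of weight `0` iff it is FREE of the slots in `H` (ours).
[cite: AbramovichTemkinWlodarczyk2024, Thm. 5.3.1 (2)–(3) (p. 1578)] -/
theorem isWeightedHomogeneous_heavyMultiweight_zero_iff (H : Set ι) [DecidablePred (· ∈ H)] (P : MvPolynomial ι k) :
    MvPolynomial.IsWeightedHomogeneous (heavyMultiweight H) P 0 ↔ ∀ d ∈ P.support, ∀ j ∈ H, d j = 0 := by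
  refine ⟨fun h d hd => (weight_heavyMultiweight_eq_zero_iff H d).mp (h (MvPolynomial.mem_support_iff.mp hd)),
    fun h d hd => (weight_heavyMultiweight_eq_zero_iff H d).mpr (h d (MvPolynomial.mem_support_iff.mpr hd))⟩

/-- The slots of `H` have `heavyMultiweight`-weight `e_i`, the other slots weight `0` (ours). [cite: AbramovichTemkinWlodarczyk2024, Thm. 5.3.1 (2)–(3) (p. 1578)] -/
theorem heavyMultiweight_of_mem {H : Set ι} [DecidablePred (· ∈ H)] {i : ι} (hi : i ∈ H) :
    heavyMultiweight H i = Finsupp.single i 1 := if_pos hi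

/-- Bookkeeping (ours). [cite: AbramovichTemkinWlodarczyk2024, Thm. 5.3.1 (2)–(3) (p. 1578)] -/
theorem heavyMultiweight_of_notMem {H : Set ι} [DecidablePred (· ∈ H)] {i : ι} (hi : i ∉ H) :
    heavyMultiweight H i = 0 := if_neg hi

/-- An endomorphism of `k[ε][σ]` that fixes the scalars and `σ`, FIXES the slots of `H`, and maps every other slot to an element all of
whose `σ`-coefficients are free of the slots of `H`, is graded for the heavy multigrading (`deg σ = 0`) (ours; LEMMA XL's `X`:
"`X` fixes the slots heavier than `C`, and `X(G_h) ∈ k[ε_C, ε_LIGHT][σ]`"). [cite: AbramovichTemkinWlodarczyk2024, Thm. 5.3.1 (2)–(3) (p. 1578)] -/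
theorem isGradedHom_heavyMultiweight (H : Set ι) [DecidablePred (· ∈ H)] {Φ : (MvPolynomial ι k)[X] →+* (MvPolynomial ι k)[X]}
    (hC : ∀ c : k, Φ (C (MvPolynomial.C c)) = C (MvPolynomial.C c)) (hX : Φ X = X)
    (hH : ∀ i ∈ H, Φ (C (MvPolynomial.X i)) = C (MvPolynomial.X i))
    (hL : ∀ i ∉ H, ∀ s : ℕ, ∀ d ∈ ((Φ (C (MvPolynomial.X i))).coeff s).support, ∀ j ∈ H, d j = 0) :
    IsGradedHom (heavyMultiweight H) (0 : ι →₀ ℤ) Φ where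
  map_C_C := hC
  isTW_X := by rw [hX]; exact isTW_X
  isTW_CX i := by
    by_cases hi : i ∈ H
    · rw [hH i hi]
      exact isTW_C (MvPolynomial.isWeightedHomogeneous_X k (heavyMultiweight H) i)
    · rw [heavyMultiweight_of_notMem hi]
      intro s
      rw [smul_zero, sub_zero]
      exact (isWeightedHomogeneous_heavyMultiweight_zero_iff H _).mpr (hL i hi s)

/-- **LEMMA XL's decomposition step**: with `X` as in `isGradedHom_heavyMultiweight`, `X(g) = g` implies `X(g_e) = g_e` for the part `g_e`
of `g` of every heavy exponent `e` (ours). [cite: AbramovichTemkinWlodarczyk2024, Thm. 5.3.1 (2)–(3) (p. 1578)] -/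
theorem isIsotropyOf_heavyComponent (H : Set ι) [DecidablePred (· ∈ H)] {Φ : (MvPolynomial ι k)[X] →+* (MvPolynomial ι k)[X]}
    (hC : ∀ c : k, Φ (C (MvPolynomial.C c)) = C (MvPolynomial.C c)) (hX : Φ X = X)
    (hH : ∀ i ∈ H, Φ (C (MvPolynomial.X i)) = C (MvPolynomial.X i))
    (hL : ∀ i ∉ H, ∀ s : ℕ, ∀ d ∈ ((Φ (C (MvPolynomial.X i))).coeff s).support, ∀ j ∈ H, d j = 0)
    {g : MvPolynomial ι k} (hg : IsIsotropyOf g Φ) (e : ι →₀ ℤ) :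
    IsIsotropyOf (MvPolynomial.weightedHomogeneousComponent (heavyMultiweight H) e g) Φ :=
  (isGradedHom_heavyMultiweight H hC hX hH hL).isIsotropyOf_weightedHomogeneousComponent hg e

end Heavy

section Factor

variable {k : Type*} [CommRing k] {ι : Type*}

/-- `g_e`: the part of `g` of heavy exponent `e` — the `heavyMultiweight H`-component of weight `wt(e)` (ours; LEMMA XL's `h·G_h` with
`h = ε^e`). [cite: AbramovichTemkinWlodarczyk2024, Thm. 5.3.1 (2)–(3) (p. 1578)] -/
noncomputable def heavyComponent (H : Set ι) [DecidablePred (· ∈ H)] (e : ι →₀ ℕ) (g : MvPolynomial ι k) : MvPolynomial ι k :=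
  MvPolynomial.weightedHomogeneousComponent (heavyMultiweight H) (Finsupp.weight (heavyMultiweight H) e) g

/-- `G_e := g_e / ε^e` (Mathlib's `divMonomial`; ours). [cite: AbramovichTemkinWlodarczyk2024, Thm. 5.3.1 (2)–(3) (p. 1578)] -/
noncomputable def heavyQuotient (H : Set ι) [DecidablePred (· ∈ H)] (e : ι →₀ ℕ) (g : MvPolynomial ι k) : MvPolynomial ι k :=
  MvPolynomial.divMonomial (heavyComponent H e g) e

/-- Every monomial of `g_e` has heavy exponent exactly `e`: `d j = e j` for `j ∈ H` (ours). [cite: AbramovichTemkinWlodarczyk2024, Thm. 5.3.1 (2)–(3) (p. 1578)] -/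
theorem apply_eq_of_mem_support_heavyComponent (H : Set ι) [DecidablePred (· ∈ H)] (e : ι →₀ ℕ) (g : MvPolynomial ι k)
    {d : ι →₀ ℕ} (hd : d ∈ (heavyComponent H e g).support) {j : ι} (hj : j ∈ H) : d j = e j := by
  classical
  have hw : Finsupp.weight (heavyMultiweight H) d = Finsupp.weight (heavyMultiweight H) e :=
    MvPolynomial.weightedHomogeneousComponent_isWeightedHomogeneous (w := heavyMultiweight H)
      (Finsupp.weight (heavyMultiweight H) e) g (MvPolynomial.mem_support_iff.mp hd)
  have := congrArg (fun f : ι →₀ ℤ => f j) hw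
  simp only [weight_heavyMultiweight_apply, if_pos hj] at this
  exact_mod_cast this

/-- If `e` is supported in `H`, then `ε^e` divides `g_e` exactly: `g_e mod ε^e = 0` (ours). [cite: AbramovichTemkinWlodarczyk2024, Thm. 5.3.1 (2)–(3) (p. 1578)] -/
theorem modMonomial_heavyComponent (H : Set ι) [DecidablePred (· ∈ H)] {e : ι →₀ ℕ} (he : ∀ j ∉ H, e j = 0)
    (g : MvPolynomial ι k) : MvPolynomial.modMonomial (heavyComponent H e g) e = 0 := by
  classical
  ext m
  rw [MvPolynomial.coeff_zero]
  by_cases hle : e ≤ m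
  · exact MvPolynomial.coeff_modMonomial_of_le _ hle
  · rw [MvPolynomial.coeff_modMonomial_of_not_le _ hle, ← MvPolynomial.notMem_support_iff]
    intro hm
    refine hle fun j => ?_
    by_cases hj : j ∈ H
    · exact (apply_eq_of_mem_support_heavyComponent H e g hm hj).ge
    · rw [he j hj]; exact Nat.zero_le _

/-- **Factorisation `g_e = ε^e · G_e`** for `e` supported in `H` (ours). [cite: AbramovichTemkinWlodarczyk2024, Thm. 5.3.1 (2)–(3) (p. 1578)] -/
theorem heavyComponent_eq_monomial_mul_heavyQuotient (H : Set ι) [DecidablePred (· ∈ H)] {e : ι →₀ ℕ}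
    (he : ∀ j ∉ H, e j = 0) (g : MvPolynomial ι k) :
    heavyComponent H e g = MvPolynomial.monomial e 1 * heavyQuotient H e g := by
  have h := MvPolynomial.divMonomial_add_modMonomial (heavyComponent H e g) e
  rw [modMonomial_heavyComponent H he g, add_zero] at h
  exact h.symm

/-- `G_e` is FREE of the slots of `H` (ours; LEMMA XL: `G_h ∈ k[ε_C, ε_LIGHT]`). [cite: AbramovichTemkinWlodarczyk2024, Thm. 5.3.1 (2)–(3) (p. 1578)] -/
theorem heavyQuotient_apply_eq_zero (H : Set ι) [DecidablePred (· ∈ H)] (e : ι →₀ ℕ) (g : MvPolynomial ι k)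
    {d : ι →₀ ℕ} (hd : d ∈ (heavyQuotient H e g).support) {j : ι} (hj : j ∈ H) : d j = 0 := by
  rw [MvPolynomial.mem_support_iff, heavyQuotient, MvPolynomial.coeff_divMonomial, ← MvPolynomial.mem_support_iff] at hd
  have := apply_eq_of_mem_support_heavyComponent H e g hd hj
  rw [Finsupp.add_apply] at this
  omega

/-- Equivalently, `G_e` is `heavyMultiweight H`-homogeneous of weight `0` (ours). [cite: AbramovichTemkinWlodarczyk2024, Thm. 5.3.1 (2)–(3) (p. 1578)] -/
theorem isWeightedHomogeneous_heavyQuotient (H : Set ι) [DecidablePred (· ∈ H)] (e : ι →₀ ℕ) (g : MvPolynomial ι k) :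
    MvPolynomial.IsWeightedHomogeneous (heavyMultiweight H) (heavyQuotient H e g) 0 :=
  (isWeightedHomogeneous_heavyMultiweight_zero_iff H _).mpr fun _ hd _ hj => heavyQuotient_apply_eq_zero H e g hd hj

/-- **LEMMA XL's decomposition step, conclusion `X(G_e) = G_e`**: with `X` fixing the scalars, `σ` and the slots of `H` and mapping the
other slots to `H`-free elements, `X(g) = g` implies `X(G_e) = G_e` for every heavy exponent `e` supported in `H` (ours).
[cite: AbramovichTemkinWlodarczyk2024, Thm. 5.3.1 (2)–(3) (p. 1578)] -/
theorem isIsotropyOf_heavyQuotient (H : Set ι) [DecidablePred (· ∈ H)] {Φ : (MvPolynomial ι k)[X] →+* (MvPolynomial ι k)[X]}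
    (hC : ∀ c : k, Φ (C (MvPolynomial.C c)) = C (MvPolynomial.C c)) (hX : Φ X = X)
    (hH : ∀ i ∈ H, Φ (C (MvPolynomial.X i)) = C (MvPolynomial.X i))
    (hL : ∀ i ∉ H, ∀ s : ℕ, ∀ d ∈ ((Φ (C (MvPolynomial.X i))).coeff s).support, ∀ j ∈ H, d j = 0)
    {g : MvPolynomial ι k} (hg : IsIsotropyOf g Φ) {e : ι →₀ ℕ} (he : ∀ j ∉ H, e j = 0) :
    IsIsotropyOf (heavyQuotient H e g) Φ := by
  have h := isIsotropyOf_heavyComponent H hC hX hH hL hg (Finsupp.weight (heavyMultiweight H) e)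
  rw [← heavyComponent, heavyComponent_eq_monomial_mul_heavyQuotient H he g] at h
  refine isIsotropyOf_of_isIsotropyOf_monomial_mul (fun i hi => hH i ?_) h
  by_contra hiH
  exact (Finsupp.mem_support_iff.mp hi) (he i hiH)

end Factor

end Literature.AlgebraicGeometry.Resolution.WeightedBlowup
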